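import Mathlib
import HarnessLib
import Summits.MatrixMultiplication.MatrixMultiplication.Theses.OrbitHarmonicsHosts
import Summits.MatrixMultiplication.MatrixMultiplication.Theorems.OrbitHarmonicsHostsHostingRestriction
import Summits.MatrixMultiplication.MatrixMultiplication.Theorems.OrbitHarmonicsHostsReesBound

/-!
# Route OrbitHarmonicsHosts — `Assembly` (item stmt-MatrixMultiplication-5460)

`Assembly : EquivariantOrbitHosting → MatrixMultiplication`.

The route file's deciding theorem `closes hX hH hR` already performs the whole reduction: from
`EquivariantOrbitHosting` at `ε > 0` take the free orbit `P = Γ·v ⊂ ℂ^d` and the hosting maps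
`α, β, γ`; push them down to the orbit-harmonics ring `ℂ[x]/⟨LF(I(P))⟩` (`γ` kills the ideal), so that
`HostingRestriction` (with the basis from `ReesBound`) exhibits `⟨N,N,N⟩` as a restriction of the
host's structure tensor; border rank is monotone under restriction and `ReesBound` bounds the host's
border rank by `|P| = |Γ| ≤ N^(2+ε)`, so Bini's theorem (`Blaser2013_thm66_holds.cubic`) gives
`ω(ℂ) ≤ 2 + ε` for every `ε > 0`, i.e. `ω(ℂ) = 2 = MatrixMultiplication`.

Both support hypotheses are landed theorems of this directory:
`hostingRestriction_proof` (`OrbitHarmonicsHostsHostingRestriction.lean`, item 5459) and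
`reesBound_proof` (`OrbitHarmonicsHostsReesBound.lean`, item 5458), so `Assembly` is their composition
with `closes`.  Nothing else is in this file.
-/

-- single-conjunct summit: the `Summit.<S>.<P>` prefix repeats `MatrixMultiplication` by design (D-0017)
set_option linter.dupNamespace false
set_option autoImplicit false

namespace Summit.MatrixMultiplication.MatrixMultiplication.Theorems

/-- **`Assembly`** (route OrbitHarmonicsHosts, item stmt-MatrixMultiplication-5460):
`EquivariantOrbitHosting → MatrixMultiplication` — the route's deciding theorem `closes` fed with the
landed support theorems `hostingRestriction_proof` (a hosting identity in a commutative algebra with a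
finite basis is a restriction of its structure tensor) and `reesBound_proof` (the orbit-harmonics ring
of a finite point set `P` has a basis of size `|P|` with structure tensor of border rank `≤ |P|`). -/
theorem orbitHarmonicsHosts_assembly_proof :
    Summit.MatrixMultiplication.MatrixMultiplication.Theses.OrbitHarmonicsHosts.Assembly := by
  unfold Summit.MatrixMultiplication.MatrixMultiplication.Theses.OrbitHarmonicsHosts.Assembly
  intro hX
  exact Summit.MatrixMultiplication.MatrixMultiplication.Theses.OrbitHarmonicsHosts.closes hX
    hostingRestriction_proof reesBound_proof

end Summit.MatrixMultiplication.MatrixMultiplication.Theorems
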